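/-
Origin: expansion seat `planner-pub-hodgecm-pv09-g3-0`, handover #3 2026-08-18T05:33:14Z (`HOME/pub-hodgecm-pv09-g3/lean/Pv09g3/PureTensorPieces.lean`, md5 56adc585, 250 lines);
landed by the gen-6 packager in gate run 23 as `HodgeCM/PerL34/PureTensorPieces.lean` (import ^import Pv[0-9]+g[0-9]+\.→import HodgeCM.PerL34. ×1).
-/
/-
Copyright: HodgeCM publication cell (pub-hodgecm), DAG node N31, seam (I) (prover pv09, generation 3).
Released under the package licence.

# N31 seam (I), third file: pv13's CONSUMER STRUCTURES fed by name — the restricted-product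
# `EulerFactorisation.Datum` of the adelic matrix coefficient and the CANONICAL local integrands
# `(U(W_i)(L_{0,v}), dy_v, ω ∘ ι_v, φ, χ′ ∘ ι_v)`, with `D_I` definitional

Source under adjudication (NOT cited as a fact; this file PROVES a typed piece of its seam):
PerL v5 = `inputs/2001/summits__hodge-w-picard-modular-quadrilinear-period-galois-
closure__free__y1__paper__paper.tex`, Lemma 4.2(b), proof, tex ll. 608–609 and l. 612, verbatim:

  608: ... $=\int_{\U(W_i)(\A)}\langle\omega(y)\varphi,\varphi\rangle\,\chi'(y)\,dy$.
  609: For $\varphi=\otimes\varphi_v$ the last integral is $\prod_v I_v(\varphi_v)$,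
       $I_v(\varphi_v):=\int_{\U(W_i)(L_{0,v})}\langle\omega_v(y)\varphi_v,\varphi_v\rangle\,
       \chi'_v(y)\,dy$.
  612: ... with $I_v(\varphi_v)$ real ...

## Position in the DAG / what this file does

pv13's S3 constructor `EulerFactorisation.LocalFactorPieces` (LANDED run 21) takes, per candidate
`(W_i, μ_i, χ′_i)`, the restricted-product datum `D : EulerFactorisation.Datum μ (⟪φ, ω y φ⟫ χ′ y) V`
(whose fields POSIT the pure-tensor shape `pure_tensor`, global integrability and multipliability),
local integrands `loc : V → LocalIntegrand`, and the compatibility `D_I : ∀ v, D.I v = (loc v).Ic`.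
This file PRODUCES all three from the global pair `(ω, φ)`, a continuous unitary character `χ′` and
pv11's measure datum (constructed by pv09-g2) — using the first two files of this seat:

* §1 `inclHom B i : G i →* Πʳ j, [G j, B j]` (Mathlib's `RestrictedProduct.mulSingle` as a
  homomorphism) and the **canonical local integrand** `localIntegrand B D ω φ χ i : LocalIntegrand`
  — group `G i`, measure `D.ν i`, the SAME Hilbert space, `ω ∘ ι_i`, the SAME vector `φ`, and
  `χ′ ∘ ι_i`; its integrand is `localCoeff B ω φ i g * χ′_i g` and its `Ic` is
  `∫ localCoeff · χ′_i dν_i` (both `rfl`); reality of `I_v` (l. 612) is then pv13's KERNEL theorem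
  `LocalIntegrand.integral_real` (needs `D.ν i` inversion-invariant — automatic for a regular Haar
  measure on an abelian locally compact group, Mathlib `IsHaarMeasure.isInvInvariant_of_regular`).
* §2 **`eulerDatum`**: pv13's `EulerFactorisation.Datum D.μ (fun y => ⟪φ, ω y φ⟫ * χ′ y) ι` BUILT (via
  pv11's `toEulerDatum`, whose analytic fields are pv11's theorems) from `hD : IsCoordinate D`,
  `hK` (φ fixed by the box subgroup `K_T`), `hM` (product formula for the matrix coefficient on the
  finite levels), `Continuous χ′`, measurability of the integrand, and the local `L¹` data of
  `localCoeff`; `eulerDatum_I` : its local factors ARE `(localIntegrand … i).Ic` — pv13's field `D_I`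
  holds by `rfl` up to pv11's `toEulerDatum_I`.
* §3 `hEuler_of_fixedVector_via_pv13` : the two routes agree — pv13's `Datum.hEuler_of` on
  `eulerDatum` gives the same `hEuler` binder as `PureTensorCoeff.hEuler_of_fixedVector`.

RESIDUAL after this file (honest, = that of `PureTensorCoeff`): `hK`, `hM`, continuity of `χ′` (and
of the orbit map if `hfm` is to be discharged), local `L¹` bounds; and, for `LocalFactorPieces`, its
OTHER fields (N31e `hN31e` — PRODUCED by pv09 gen 1; `hnorm` — pv05; `ram_pos` — pv07
`PiecesRamPos` / `PiecesSplit` ON `LocalIntegrand`, hence now on the canonical local integrands of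
the global pair; `split_val` / `nonsplit_val` / `summable_t` — N31g).  Nothing is cited; no
hypothesis names PerL, QW8 or a 2001-programme claim.  Imports: this seat's `PureTensorCoeff` +
LANDED `HodgeCM.PerL34.EulerDatumOfL1` (pv11) + `HodgeCM.PerL34.LocalFactorPieces` (pv13); axioms =
the standard trio.  Unit `pub-hodgecm-pv09-g3` (DAG-node prover #09, generation 3), 2026-08-18.
-/
import Summits.HodgeConjecture.HodgeCM.PerL34.PureTensorCoeff
import Summits.HodgeConjecture.HodgeCM.PerL34.EulerDatumOfL1
import Summits.HodgeConjecture.HodgeCM.PerL34.LocalFactorPieces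

set_option autoImplicit false

noncomputable section

open MeasureTheory Set Filter Function Topology Complex ComplexConjugate

open scoped RestrictedProduct InnerProductSpace

namespace HodgeCM.PerL34.PureTensor

open HodgeCM.PerL34.AdelicFactorisation HodgeCM.PerL34.RestrictedMeasure
  HodgeCM.PerL34.NoSmallSubgroups HodgeCM.PerL34.EulerFactorisation

/-! ## §1 The canonical local integrands -/

section incl

variable {ι : Type} {G : ι → Type} [∀ i, Group (G i)] [DecidableEq ι]
  {Sub : ι → Type*} [∀ i, SetLike (Sub i) (G i)] [∀ i, SubgroupClass (Sub i) (G i)]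
  (B : ∀ i, Sub i)

/-- The inclusion of the `i`-th factor `ι_i : G i →* Πʳ j, [G j, B j]` (`RestrictedProduct.mulSingle`
as a homomorphism; Deitmar §6.3 "embedded via x ↦ (…, 1, x, 1, …)"). -/
def inclHom (i : ι) : G i →* Πʳ j, [G j, B j] where
  toFun := RestrictedProduct.mulSingle B i
  map_one' := RestrictedProduct.mulSingle_one B i
  map_mul' := RestrictedProduct.mulSingle_mul B i

/-- (Ported verbatim from the HodgeCMPerL package; no docstring in the source.) -/
@[simp] theorem inclHom_apply (i : ι) (g : G i) :
    inclHom B i g = RestrictedProduct.mulSingle B i g := rfl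

variable {Sp : Type} [NormedAddCommGroup Sp] [InnerProductSpace ℂ Sp]

/-- The local component `χ′_i = χ′ ∘ ι_i` of a unitary character satisfies `χ′_i(g⁻¹) = conj χ′_i(g)`. -/
theorem localChar_inv (χ : (Πʳ j, [G j, B j]) →* Circle) (i : ι) (g : G i) :
    ((χ (RestrictedProduct.mulSingle B i g⁻¹) : Circle) : ℂ) =
      conj ((χ (RestrictedProduct.mulSingle B i g) : Circle) : ℂ) := by
  rw [RestrictedProduct.mulSingle_inv, map_inv, Circle.coe_inv_eq_conj]

variable [∀ i, MeasurableSpace (G i)] [∀ i, MeasurableInv (G i)]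

/-- **The canonical local integrand at `i`** of the global data `(D, ω, φ, χ′)`: pv13's
`LocalIntegrand` with group `G i`, measure `D.ν i` (inversion-invariant), the same Hilbert space and
vector, the representation `ω ∘ ι_i` and the character values `χ′ ∘ ι_i`. -/
def localIntegrand (D : RestrictedProductMeasureDatum ι G (Πʳ j, [G j, B j]))
    [∀ i, (D.ν i).IsInvInvariant] (ω : (Πʳ j, [G j, B j]) →* (Sp ≃ₗᵢ[ℂ] Sp)) (φ : Sp)
    (χ : (Πʳ j, [G j, B j]) →* Circle) (i : ι) : LocalIntegrand where
  G := G i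
  μ := D.ν i
  Sp := Sp
  ω := ω.comp (inclHom B i)
  φ := φ
  χ := fun g => ((χ (RestrictedProduct.mulSingle B i g) : Circle) : ℂ)
  chi_inv := localChar_inv B χ i

variable (D : RestrictedProductMeasureDatum ι G (Πʳ j, [G j, B j])) [∀ i, (D.ν i).IsInvInvariant]
  (ω : (Πʳ j, [G j, B j]) →* (Sp ≃ₗᵢ[ℂ] Sp)) (φ : Sp) (χ : (Πʳ j, [G j, B j]) →* Circle)

/-- Its integrand is `localCoeff B ω φ i g * χ′_i g` … -/
theorem localIntegrand_f (i : ι) (g : G i) :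
    (localIntegrand B D ω φ χ i).f g =
      localCoeff B ω φ i g * ((χ (RestrictedProduct.mulSingle B i g) : Circle) : ℂ) := rfl

/-- … and its complex local factor is `∫ localCoeff · χ′_i dν_i`. -/
theorem localIntegrand_Ic (i : ι) :
    (localIntegrand B D ω φ χ i).Ic =
      ∫ g, localCoeff B ω φ i g * ((χ (RestrictedProduct.mulSingle B i g) : Circle) : ℂ) ∂D.ν i :=
  rfl

/-- **l. 612 for the canonical local factors, KERNEL** (pv13 `LocalIntegrand.integral_real`):
`∫ localCoeff · χ′_i dν_i` is the real number `(localIntegrand … i).I`. -/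
theorem localIntegral_real (i : ι) :
    ∫ g, localCoeff B ω φ i g * ((χ (RestrictedProduct.mulSingle B i g) : Circle) : ℂ) ∂D.ν i =
      ((localIntegrand B D ω φ χ i).I : ℂ) :=
  (localIntegrand B D ω φ χ i).integral_real

end incl

/-! ## §2 pv13's `EulerFactorisation.Datum` of the adelic matrix coefficient, BUILT -/

section datum

variable {ι : Type} {G : ι → Type} [∀ i, CommGroup (G i)] [∀ i, MeasurableSpace (G i)]
  [∀ i, TopologicalSpace (G i)] [∀ i, OpensMeasurableSpace (G i)]
  {Sub : ι → Type*} [∀ i, SetLike (Sub i) (G i)] [∀ i, SubgroupClass (Sub i) (G i)]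
  (B : ∀ i, Sub i) [Countable ι] [DecidableEq ι]
  {Sp : Type} [NormedAddCommGroup Sp] [InnerProductSpace ℂ Sp]

/-- **pv13's restricted-product `Datum` for `F(y) = ⟪φ, ω(y)φ⟫ χ′(y)`, BUILT**: every structural field
from pv11's measure datum `D` (pv11 `toEulerDatum`, whose `integrable` / `multipliable` are pv11's
theorems), the field `pure_tensor` from `IsCoordinate.isPureTensor_coeff` (`hK`, `hM`) times
`IsCoordinate.isPureTensor_unitaryChar` (pv10: a continuous `χ′` is trivial on a box subgroup); local
factors `localCoeff B ω φ i g * χ′_i g`. -/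
def eulerDatum (hBopen : ∀ i, IsOpen (B i : Set (G i)))
    (D : RestrictedProductMeasureDatum ι G (Πʳ j, [G j, B j])) (hD : IsCoordinate D)
    (ω : (Πʳ j, [G j, B j]) →* (Sp ≃ₗᵢ[ℂ] Sp)) (φ : Sp)
    (χ : (Πʳ j, [G j, B j]) →* Circle) (hχ : Continuous χ) {T : Finset ι}
    (hK : ∀ k ∈ RestrictedProduct.boxSubgroup B T, ω k φ = φ)
    (hM : ∀ S : Finset ι, T ⊆ S → ∀ y : (i : ↥S) → G i,
      inner ℂ φ (ω (extendOne B S y) φ) = ∏ i : ↥S, localCoeff B ω φ i (y i))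
    (hfm : AEStronglyMeasurable (fun y => inner ℂ φ (ω y φ) * ((χ y : Circle) : ℂ)) D.μ)
    (hcl : ∀ i, Integrable (localCoeff B ω φ i) (D.ν i))
    (hB : ∃ C : ℝ, ∀ S : Finset ι, D.S₀ ⊆ S → T ⊆ S →
      ∏ i ∈ S, ∫ x, ‖localCoeff B ω φ i x‖ ∂D.ν i ≤ C) :
    EulerFactorisation.Datum D.μ (fun y => ⟪φ, ω y φ⟫_ℂ * ((χ y : Circle) : ℂ)) ι :=
  D.toEulerDatum (T := T ∪ (exists_boxSubgroup_le_ker B hBopen χ hχ).choose)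
    (fl := fun i g => localCoeff B ω φ i g * ((χ (RestrictedProduct.mulSingle B i g) : Circle) : ℂ))
    ((hD.isPureTensor_coeff B ω φ hK hM).mul
      (hD.isPureTensor_unitaryChar B χ (exists_boxSubgroup_le_ker B hBopen χ hχ).choose_spec))
    hfm
    (fun i => integrable_mul_of_norm_le_one (hcl i)
      (continuous_localComponent B χ hχ i).aestronglyMeasurable fun x => (Circle.norm_coe _).le)
    (by
      obtain ⟨C, hC⟩ := hB
      refine ⟨C, fun S hS₀ hTS => ?_⟩
      have h := hC S hS₀ (Finset.subset_union_left.trans hTS)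
      simpa only [norm_mul_coe_circle] using h)

/-- The local factors of the built datum are `∫ localCoeff · χ′_i dν_i` … -/
theorem eulerDatum_I (hBopen : ∀ i, IsOpen (B i : Set (G i)))
    (D : RestrictedProductMeasureDatum ι G (Πʳ j, [G j, B j])) (hD : IsCoordinate D)
    (ω : (Πʳ j, [G j, B j]) →* (Sp ≃ₗᵢ[ℂ] Sp)) (φ : Sp)
    (χ : (Πʳ j, [G j, B j]) →* Circle) (hχ : Continuous χ) {T : Finset ι}
    (hK : ∀ k ∈ RestrictedProduct.boxSubgroup B T, ω k φ = φ)
    (hM : ∀ S : Finset ι, T ⊆ S → ∀ y : (i : ↥S) → G i,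
      inner ℂ φ (ω (extendOne B S y) φ) = ∏ i : ↥S, localCoeff B ω φ i (y i))
    (hfm : AEStronglyMeasurable (fun y => inner ℂ φ (ω y φ) * ((χ y : Circle) : ℂ)) D.μ)
    (hcl : ∀ i, Integrable (localCoeff B ω φ i) (D.ν i))
    (hB : ∃ C : ℝ, ∀ S : Finset ι, D.S₀ ⊆ S → T ⊆ S →
      ∏ i ∈ S, ∫ x, ‖localCoeff B ω φ i x‖ ∂D.ν i ≤ C) (i : ι) :
    (eulerDatum B hBopen D hD ω φ χ hχ hK hM hfm hcl hB).I i =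
      ∫ g, localCoeff B ω φ i g * ((χ (RestrictedProduct.mulSingle B i g) : Circle) : ℂ) ∂D.ν i :=
  rfl

/-- … i.e. pv13's compatibility FIELD `LocalFactorPieces.D_I` (`D.I v = (loc v).Ic`) holds
DEFINITIONALLY for the built datum and the canonical local integrands. -/
theorem eulerDatum_I_eq_localIntegrand [∀ i, MeasurableInv (G i)] (hBopen : ∀ i, IsOpen (B i : Set (G i)))
    (D : RestrictedProductMeasureDatum ι G (Πʳ j, [G j, B j])) [∀ i, (D.ν i).IsInvInvariant]
    (hD : IsCoordinate D) (ω : (Πʳ j, [G j, B j]) →* (Sp ≃ₗᵢ[ℂ] Sp)) (φ : Sp)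
    (χ : (Πʳ j, [G j, B j]) →* Circle) (hχ : Continuous χ) {T : Finset ι}
    (hK : ∀ k ∈ RestrictedProduct.boxSubgroup B T, ω k φ = φ)
    (hM : ∀ S : Finset ι, T ⊆ S → ∀ y : (i : ↥S) → G i,
      inner ℂ φ (ω (extendOne B S y) φ) = ∏ i : ↥S, localCoeff B ω φ i (y i))
    (hfm : AEStronglyMeasurable (fun y => inner ℂ φ (ω y φ) * ((χ y : Circle) : ℂ)) D.μ)
    (hcl : ∀ i, Integrable (localCoeff B ω φ i) (D.ν i))
    (hB : ∃ C : ℝ, ∀ S : Finset ι, D.S₀ ⊆ S → T ⊆ S →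
      ∏ i ∈ S, ∫ x, ‖localCoeff B ω φ i x‖ ∂D.ν i ≤ C) (i : ι) :
    (eulerDatum B hBopen D hD ω φ χ hχ hK hM hfm hcl hB).I i = (localIntegrand B D ω φ χ i).Ic :=
  rfl

/-- The local factors of the built datum are REAL (l. 612, kernel via pv13). -/
theorem eulerDatum_I_real [∀ i, MeasurableInv (G i)] (hBopen : ∀ i, IsOpen (B i : Set (G i)))
    (D : RestrictedProductMeasureDatum ι G (Πʳ j, [G j, B j])) [∀ i, (D.ν i).IsInvInvariant]
    (hD : IsCoordinate D) (ω : (Πʳ j, [G j, B j]) →* (Sp ≃ₗᵢ[ℂ] Sp)) (φ : Sp)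
    (χ : (Πʳ j, [G j, B j]) →* Circle) (hχ : Continuous χ) {T : Finset ι}
    (hK : ∀ k ∈ RestrictedProduct.boxSubgroup B T, ω k φ = φ)
    (hM : ∀ S : Finset ι, T ⊆ S → ∀ y : (i : ↥S) → G i,
      inner ℂ φ (ω (extendOne B S y) φ) = ∏ i : ↥S, localCoeff B ω φ i (y i))
    (hfm : AEStronglyMeasurable (fun y => inner ℂ φ (ω y φ) * ((χ y : Circle) : ℂ)) D.μ)
    (hcl : ∀ i, Integrable (localCoeff B ω φ i) (D.ν i))
    (hB : ∃ C : ℝ, ∀ S : Finset ι, D.S₀ ⊆ S → T ⊆ S →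
      ∏ i ∈ S, ∫ x, ‖localCoeff B ω φ i x‖ ∂D.ν i ≤ C) (i : ι) :
    (eulerDatum B hBopen D hD ω φ χ hχ hK hM hfm hcl hB).I i =
      ((localIntegrand B D ω φ χ i).I : ℂ) :=
  (localIntegrand B D ω φ χ i).integral_real

/-! ## §3 The two routes to `hEuler` agree -/

/-- pv09's `hEuler` binder READ OFF pv13's `Datum.hEuler_of` for the built datum: for real local
values `I_i` with `∫ localCoeff · χ′_i = I_i` and any `HasProd I P`, `∫ ⟪φ, ω y φ⟫ χ′(y) dμ = P`.
(With `P := ∏' i, I i` this is `PureTensorCoeff.hEuler_of_fixedVector`, whose `HasProd` comes from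
pv11's `hasProd_integral`; here any producer of `HasProd`, e.g. pv13 `EulerProduct.hasProd_eulerValue`,
may be plugged in.) -/
theorem hEuler_of_fixedVector_via_pv13 (hBopen : ∀ i, IsOpen (B i : Set (G i)))
    (D : RestrictedProductMeasureDatum ι G (Πʳ j, [G j, B j])) (hD : IsCoordinate D)
    (ω : (Πʳ j, [G j, B j]) →* (Sp ≃ₗᵢ[ℂ] Sp)) (φ : Sp)
    (χ : (Πʳ j, [G j, B j]) →* Circle) (hχ : Continuous χ) {T : Finset ι}
    (hK : ∀ k ∈ RestrictedProduct.boxSubgroup B T, ω k φ = φ)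
    (hM : ∀ S : Finset ι, T ⊆ S → ∀ y : (i : ↥S) → G i,
      inner ℂ φ (ω (extendOne B S y) φ) = ∏ i : ↥S, localCoeff B ω φ i (y i))
    (hfm : AEStronglyMeasurable (fun y => inner ℂ φ (ω y φ) * ((χ y : Circle) : ℂ)) D.μ)
    (hcl : ∀ i, Integrable (localCoeff B ω φ i) (D.ν i))
    (hB : ∃ C : ℝ, ∀ S : Finset ι, D.S₀ ⊆ S → T ⊆ S →
      ∏ i ∈ S, ∫ x, ‖localCoeff B ω φ i x‖ ∂D.ν i ≤ C)
    {I : ι → ℝ} {P : ℝ} (hI : ∀ i, ∫ x, localCoeff B ω φ i x *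
      ((χ (RestrictedProduct.mulSingle B i x) : Circle) : ℂ) ∂D.ν i = (I i : ℂ)) (hP : HasProd I P) :
    ∫ y, ⟪φ, ω y φ⟫_ℂ * ((χ y : Circle) : ℂ) ∂D.μ = (P : ℂ) :=
  (eulerDatum B hBopen D hD ω φ χ hχ hK hM hfm hcl hB).hEuler_of (fun i => hI i) hP

end datum

end HodgeCM.PerL34.PureTensor

end
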